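import Literature.FieldTheory.Separability.PDegreeSeparablyGenerated
import Literature.AlgebraicGeometry.Resolution.AffineDomainEquidim
import Literature.AlgebraicGeometry.Resolution.AffineDomainDimension
import Literature.AlgebraicGeometry.Resolution.ArithmeticalThreefolds
import Literature.AlgebraicGeometry.Resolution.LocalBlowup
import Mathlib.RingTheory.Valuation.ValuationSubring
import HarnessLib

/-!
# Crux `Steer` (stmt-ResolutionOfSingularities-16345), line `switching_dichotomy`: the `p`-DEGREE OF THE
# FUNCTION FIELD READ AT THE CENTRE OF A MODEL, `[K : K^p] = p ^ dim S` (glue `HDEG` of the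
# `stub_logFinalExitM` leaf, skeleton r19)

OURS (campaign `res-hironaka`, rung L ★L-G4, slot W4.1, chain W4.1; unit `res-L0-w41-stub-1` g3, named by
the assembler res-L0-w41-stub-9 = res-D-pv-014, «stub-1: take HDEG», 2026-08-27; helper for line
`switching_dichotomy` of crux `Steer`, holder res-L0-w41-lead-1; replaces the role of no printed item; NOT
a statement of the manuscript under review [claim: Hironaka2017, status: under-review]; AI-produced, which
is weaker than expert review). Theses-free and definition-free.

**Statement (`finrank_frobenius_eq_pow_dim_succ`).** `k ⊆ K` fields, `k` PERFECT, `char K = p`;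
`A₀ ≤ A₁ ⊆ O` `k`-subalgebras of `K` with `A₁` finitely generated, `t ^ p ∈ A₀` and `Frac (A₀[t]) = K`
(the radicand datum); `O` a valuation ring of `K` ZERO-DIMENSIONAL over `k` (every element of `O` is a
root modulo `𝔪_O` of a non-zero polynomial over `k` — the skeleton's `ZeroDim`, unfolded); the local ring
`S := locAtCentre A₁ O = (A₁)_{𝔪_O ∩ A₁} ⊆ K` of dimension `n + 1`. Then `[K : K^p] = p ^ (n + 1)`
(`K^p = (frobenius K p).fieldRange`). This is the hypothesis `hdeg` of
`ConstantsPthPowers.mem_iff` (p501888) in the E1 assembly of `stub_logFinalExitM`, where `n` is the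
size of the content frame and `dim S = n + 1` comes from `ContentFrame.exists_frame_locAtCentre` (p500897).

**Proof.** `[K : K^p] = p ^ {tr.deg_k K}` for `K` essentially of finite type over the perfect `k`
(Matsumura Thm. 26.5: `Literature.FieldTheory.Separability.finrank_frobenius_eq_pow_of_trdeg_eq`,
res-L0-w41-stub-10 p497687/p497884; `K = Frac (A₁[t])`); `tr.deg_k K = tr.deg_k A₁` since `K` is
algebraic over `A₁` (`trdeg_eq_of_isFractionRing_adjoin_insert`: `t ^ p ∈ A₁`, additivity of `tr.deg`);
`tr.deg_k A₁ = dim A₁` (Matsumura Thm. 5.6, tree `exists_ringKrullDim_eq_and_trdeg_eq`); the centre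
`𝔪_O ∩ A₁` is MAXIMAL by zero-dimensionality (`A₁ / 𝔪` is a domain algebraic over `k`), so
`dim (A₁)_𝔪 = dim A₁` (equidimensionality of affine domains at closed points, tree
`ringKrullDim_localization_atPrime_eq_of_isMaximal`), and `(A₁)_𝔪 ≅ S` (`locAtCentreEquiv`).
[cite: Matsumura1987, Thm. 26.5; §5 Thm. 5.6 and Ex. 5.1] [folklore]
-/

noncomputable section

-- `Summit.<S>.<S>.…` duplicates the summit name by design (single-problem summit).
set_option linter.dupNamespace false

namespace Summit.ResolutionOfSingularities.ResolutionOfSingularities.Theorems.SwitchingDichotomy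

namespace PDegreeAtCentre

open IsLocalRing Polynomial
open Literature.AlgebraicGeometry.Resolution

variable {k K : Type} [Field k] [Field K] [Algebra k K]

-- adapted from Theorems/ValuativeLuAlphaPTorsorChartRegular.lean (`isMaximal_centre_of_zeroDim`), kept
-- private here so that this file stays outside every route cone
/-- The centre of a zero-dimensional valuation ring on a `k`-subalgebra `R ⊆ O` is a maximal ideal of
`R` (the quotient is a domain algebraic over `k`). [folklore] -/
private theorem isMaximal_centre (O : ValuationSubring K)
    (hzd : ∀ z : K, z ∈ O → ∃ f : k[X], f ≠ 0 ∧ aeval z f ∈ O.nonunits)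
    (R : Subalgebra k K) (hRO : R.toSubring ≤ O.toSubring) :
    (Ideal.comap (Subring.inclusion hRO) (maximalIdeal O)).IsMaximal := by
  classical
  set 𝔭 : Ideal R.toSubring := Ideal.comap (Subring.inclusion hRO) (maximalIdeal O) with h𝔭
  haveI h𝔭p : 𝔭.IsPrime := Ideal.comap_isPrime _ _
  letI : Algebra k R.toSubring := R.algebra
  haveI : IsDomain (R.toSubring ⧸ 𝔭) := Ideal.Quotient.isDomain 𝔭
  have hint : Algebra.IsIntegral k (R.toSubring ⧸ 𝔭) := by
    refine ⟨fun z => ?_⟩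
    obtain ⟨r, rfl⟩ := Ideal.Quotient.mk_surjective z
    obtain ⟨f, hf0, hf⟩ := hzd (r : K) (hRO r.2)
    refine IsAlgebraic.isIntegral ⟨f, hf0, ?_⟩
    have h1 : aeval (Ideal.Quotient.mk 𝔭 r) f = Ideal.Quotient.mkₐ k 𝔭 (aeval r f) := by
      rw [← aeval_algHom_apply]
      rfl
    rw [h1, Ideal.Quotient.mkₐ_eq_mk, Ideal.Quotient.eq_zero_iff_mem, h𝔭, Ideal.mem_comap]
    have h2 : ((aeval r f : R.toSubring) : K) = aeval (r : K) f := (Subalgebra.aeval_coe R r f).symm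
    have h3 : O.valuation ((aeval r f : R.toSubring) : K) < 1 := by
      rw [h2]
      exact (ValuationSubring.mem_nonunits_iff O).mp hf
    exact (ValuationSubring.valuation_lt_one_iff O _).mpr h3
  have hfield : IsField (R.toSubring ⧸ 𝔭) := by
    haveI := hint
    exact (Algebra.IsIntegral.isField_iff_isField (R := k) (S := R.toSubring ⧸ 𝔭)
      (FaithfulSMul.algebraMap_injective k _)).mp (Field.toIsField k)
  exact Ideal.Quotient.maximal_of_isField 𝔭 hfield

/-- **`A₁[t]` is integral over `A₁` when `t ^ p ∈ A₁` (`p ≠ 0`)**, read in `K`: every element of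
`adjoin k (A₁ ∪ {t})` is integral over `A₁`. [folklore] -/
theorem isIntegral_of_mem_adjoin_insert (A₁ : Subalgebra k K) (t : K) {p : ℕ} (hp : p ≠ 0)
    (htp : t ^ p ∈ A₁) {x : K} (hx : x ∈ Algebra.adjoin k (insert t (A₁ : Set K))) :
    IsIntegral A₁ x := by
  refine Algebra.adjoin_induction (p := fun x _ => IsIntegral A₁ x) ?_ ?_ ?_ ?_ hx
  · rintro x (rfl | hxA)
    · refine ⟨X ^ p - C ⟨x ^ p, htp⟩, monic_X_pow_sub_C _ hp, ?_⟩
      simp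
    · exact isIntegral_algebraMap (R := A₁) (A := K) (x := ⟨x, hxA⟩)
  · intro c
    exact isIntegral_algebraMap (R := A₁) (A := K) (x := ⟨algebraMap k K c, A₁.algebraMap_mem c⟩)
  · intro x y _ _ hx hy
    exact hx.add hy
  · intro x y _ _ hx hy
    exact hx.mul hy

/-- **`trdeg_k K = trdeg_k A₁`** when `K = Frac (A₁[t])` with `t ^ p ∈ A₁` (`K` is algebraic over `A₁`).
[cite: Matsumura1987, §5 Thm. 5.6] [folklore] -/
theorem trdeg_eq_of_isFractionRing_adjoin_insert (A₁ : Subalgebra k K) (t : K) {p : ℕ} (hp : p ≠ 0)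
    (htp : t ^ p ∈ A₁) (hfr : IsFractionRing (Algebra.adjoin k (insert t (A₁ : Set K))) K) :
    Algebra.trdeg k K = Algebra.trdeg k A₁ := by
  set A' : Subalgebra k K := Algebra.adjoin k (insert t (A₁ : Set K)) with hA'
  have hle : A₁ ≤ A' := fun x hx => Algebra.subset_adjoin (Set.mem_insert_of_mem _ hx)
  haveI := hfr
  -- `trdeg_k K = trdeg_k A'`
  rw [trdeg_eq_trdeg_of_isFractionRing A']
  -- the tower `k → A₁ → A'`, `A'` integral over `A₁`
  letI : Algebra A₁ A' := (Subalgebra.inclusion hle).toRingHom.toAlgebra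
  haveI : IsScalarTower k A₁ A' := IsScalarTower.of_algebraMap_eq fun _ => rfl
  haveI : FaithfulSMul A₁ A' :=
    (faithfulSMul_iff_algebraMap_injective A₁ A').mpr (Subalgebra.inclusion_injective hle)
  haveI : Algebra.IsIntegral A₁ A' := by
    refine ⟨fun x => ?_⟩
    let f : A' →ₐ[A₁] K := { A'.val with commutes' := fun _ => rfl }
    have hf : Function.Injective f := Subtype.val_injective
    exact (isIntegral_algHom_iff f hf).mp (isIntegral_of_mem_adjoin_insert A₁ t hp htp x.2)
  haveI : Algebra.IsAlgebraic A₁ A' := Algebra.IsIntegral.isAlgebraic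
  rw [← trdeg_add_eq k A₁ (A := A'), trdeg_eq_zero (R := A₁) (A := A'), add_zero]

/-- **The `p`-degree of the function field read at the centre of a model: `[K : K^p] = p ^ dim S`.**
Crux frame: `k ⊆ K` with `k` PERFECT of characteristic `p`, `A₀ ≤ A₁ ⊆ O` finitely generated
`k`-subalgebras, `t ^ p ∈ A₀`, `Frac (A₀[t]) = K`, `O` a valuation ring of `K` ZERO-DIMENSIONAL over `k`
(`ZeroDim`, unfolded), `S := (A₁)_{𝔪_O ∩ A₁} ⊆ K` of dimension `n + 1`. Then `[K : K^p] = p ^ (n + 1)`.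
Proof: `[K : K^p] = p ^ {tr.deg_k K}` (Matsumura Thm. 26.5,
`Literature.FieldTheory.Separability.finrank_frobenius_eq_pow_of_trdeg_eq`); `tr.deg_k K = tr.deg_k A₁`
(`K` algebraic over `A₁`) `= dim A₁` (Matsumura Thm. 5.6) `= dim (A₁)_𝔪` for the MAXIMAL centre
`𝔪 = 𝔪_O ∩ A₁` (zero-dimensionality; equidimensionality of affine domains at closed points) `= dim S`
(`locAtCentreEquiv`). This is the input `hdeg` of `ConstantsPthPowers.mem_iff` in the assembly of
`stub_logFinalExitM`. [cite: Matsumura1987, Thm. 26.5, Thm. 5.6] [folklore] -/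
theorem finrank_frobenius_eq_pow_dim_succ (p : ℕ) [Fact p.Prime] [CharP K p] [PerfectField k]
    (O : ValuationSubring K) (A₀ A₁ : Subalgebra k K) (t : K) (hle : A₀ ≤ A₁) (hfg₁ : A₁.FG)
    (htp : t ^ p ∈ A₀) (hfr : IsFractionRing (Algebra.adjoin k (insert t (A₀ : Set K))) K)
    (h₁ : A₁.toSubring ≤ O.toSubring)
    (hzd : ∀ x ∈ O, ∃ g : k[X], g ≠ 0 ∧ aeval x g ∈ O.nonunits) {n : ℕ}
    (hdim : ringKrullDim (locAtCentre A₁.toSubring O) = ((n + 1 : ℕ) : WithBot ℕ∞)) :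
    Module.finrank (frobenius K p).fieldRange K = p ^ (n + 1) := by
  classical
  have hp : p.Prime := Fact.out
  -- ### `K` is essentially of finite type over `k`: `K = Frac (A₁[t])`
  set A' : Subalgebra k K := Algebra.adjoin k (insert t (A₁ : Set K)) with hA'
  have hfr' : IsFractionRing A' K :=
    isFractionRing_of_le (Algebra.adjoin_mono (Set.insert_subset_insert fun x hx => hle hx)) hfr
  have hfg' : A'.FG := by
    obtain ⟨s, hs⟩ := hfg₁
    refine ⟨insert t s, ?_⟩
    rw [Finset.coe_insert, hA', ← hs, Algebra.adjoin_insert_adjoin]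
  haveI : Algebra.FiniteType k A' := A'.fg_iff_finiteType.mp hfg'
  haveI := hfr'
  haveI : Algebra.EssFiniteType A' K := Algebra.EssFiniteType.of_isLocalization K (nonZeroDivisors A')
  haveI : Algebra.EssFiniteType k K := Algebra.EssFiniteType.comp k A' K
  -- ### `trdeg_k K = dim A₁ = dim (A₁)_𝔪 = dim S = n + 1`
  haveI : Algebra.FiniteType k A₁ := A₁.fg_iff_finiteType.mp hfg₁
  obtain ⟨m, hm, htrm⟩ := exists_ringKrullDim_eq_and_trdeg_eq k A₁
  letI : Algebra k A₁.toSubring := A₁.algebra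
  haveI : Algebra.FiniteType k A₁.toSubring := A₁.fg_iff_finiteType.mp hfg₁
  haveI h𝔪 : (Ideal.comap (Subring.inclusion h₁) (maximalIdeal O)).IsMaximal :=
    isMaximal_centre O hzd A₁ h₁
  have hloc : ringKrullDim (Localization.AtPrime (Ideal.comap (Subring.inclusion h₁) (maximalIdeal O))) =
      ringKrullDim A₁.toSubring :=
    ringKrullDim_localization_atPrime_eq_of_isMaximal k _
  have hS : ringKrullDim (locAtCentre A₁.toSubring O) =
      ringKrullDim (Localization.AtPrime (Ideal.comap (Subring.inclusion h₁) (maximalIdeal O))) :=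
    (ringKrullDim_eq_of_ringEquiv (locAtCentreEquiv h₁).toRingEquiv).symm
  have hmn : m = n + 1 := by
    have h : ((m : ℕ) : WithBot ℕ∞) = ((n + 1 : ℕ) : WithBot ℕ∞) := by
      rw [← hdim, hS, hloc]
      exact hm.symm
    exact_mod_cast h
  have htr : Algebra.trdeg k K = ((n + 1 : ℕ) : Cardinal) := by
    rw [trdeg_eq_of_isFractionRing_adjoin_insert A₁ t hp.ne_zero (hle htp)
      (isFractionRing_of_le (Algebra.adjoin_mono (Set.insert_subset_insert fun x hx => hle hx)) hfr),
      htrm, hmn]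
  -- ### Matsumura Thm. 26.5
  exact Literature.FieldTheory.Separability.finrank_frobenius_eq_pow_of_trdeg_eq p htr

end PDegreeAtCentre

end Summit.ResolutionOfSingularities.ResolutionOfSingularities.Theorems.SwitchingDichotomy

end

/-! ## Appendix (append #1): the dimension of the centre ring, `dim S = tr.deg_k K` (K-T1 shape) -/

noncomputable section

-- `Summit.<S>.<S>.…` duplicates the summit name by design (single-problem summit).
set_option linter.dupNamespace false

namespace Summit.ResolutionOfSingularities.ResolutionOfSingularities.Theorems.SwitchingDichotomy

namespace PDegreeAtCentre

open IsLocalRing Polynomial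
open Literature.AlgebraicGeometry.Resolution

variable {k K : Type} [Field k] [Field K] [Algebra k K]

/-- **`dim (A₁)_{𝔪_O ∩ A₁} = tr.deg_k K` at a zero-dimensional valuation** (the K-T1 junction of the
`TailCodimBound` / `GeoDict` pieces, exported from the chain proved for `finrank_frobenius_eq_pow_dim_succ`):
`A₁ ⊆ O` a finitely generated `k`-subalgebra with `K = Frac (A₁[t])`, `t ^ p ∈ A₁` (`p ≠ 0`), `O` zero-
dimensional over `k`. Then the local ring `locAtCentre A₁ O` has Krull dimension `tr.deg_k K`: the centre
is a MAXIMAL ideal (`A₁ / 𝔪` is a domain algebraic over `k`), maximal ideals of affine domains have height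
`dim A₁ = tr.deg_k A₁` (Matsumura Thm. 5.6), and `tr.deg_k A₁ = tr.deg_k K` (`K` algebraic over `A₁`).
[cite: Matsumura1987, §5 Thm. 5.6 and Ex. 5.1] [folklore] -/
theorem ringKrullDim_locAtCentre_eq_of_trdeg_eq (O : ValuationSubring K) (A₁ : Subalgebra k K) (t : K)
    {p : ℕ} (hp : p ≠ 0) (hfg₁ : A₁.FG) (htp : t ^ p ∈ A₁)
    (hfr : IsFractionRing (Algebra.adjoin k (insert t (A₁ : Set K))) K)
    (h₁ : A₁.toSubring ≤ O.toSubring)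
    (hzd : ∀ x ∈ O, ∃ g : k[X], g ≠ 0 ∧ aeval x g ∈ O.nonunits) {n : ℕ}
    (htr : Algebra.trdeg k K = (n : Cardinal)) :
    ringKrullDim (locAtCentre A₁.toSubring O) = (n : WithBot ℕ∞) := by
  classical
  haveI : Algebra.FiniteType k A₁ := A₁.fg_iff_finiteType.mp hfg₁
  obtain ⟨m, hm, htrm⟩ := exists_ringKrullDim_eq_and_trdeg_eq k A₁
  letI : Algebra k A₁.toSubring := A₁.algebra
  haveI : Algebra.FiniteType k A₁.toSubring := A₁.fg_iff_finiteType.mp hfg₁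
  haveI h𝔪 : (Ideal.comap (Subring.inclusion h₁) (maximalIdeal O)).IsMaximal :=
    isMaximal_centre O hzd A₁ h₁
  have hloc : ringKrullDim (Localization.AtPrime (Ideal.comap (Subring.inclusion h₁) (maximalIdeal O))) =
      ringKrullDim A₁.toSubring :=
    ringKrullDim_localization_atPrime_eq_of_isMaximal k _
  have hmn : m = n := by
    have h : ((m : ℕ) : Cardinal) = (n : Cardinal) := by
      rw [← htr, trdeg_eq_of_isFractionRing_adjoin_insert A₁ t hp htp hfr, htrm]
    exact_mod_cast h
  rw [ringKrullDim_eq_of_ringEquiv (locAtCentreEquiv h₁).toRingEquiv.symm]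
  exact hloc.trans (hmn ▸ hm)

/-- **K-T1 in the crux frame** (`A₀ ≤ A₁`, `t ^ p ∈ A₀`, `Frac (A₀[t]) = K`, `p` prime): every local ring
`locAtCentre A₁ O` of a finitely generated model `A₁ ⊇ A₀` inside the zero-dimensional `O` has Krull
dimension `tr.deg_k K`. [cite: Matsumura1987, §5 Thm. 5.6 and Ex. 5.1] [folklore] -/
theorem ringKrullDim_locAtCentre_eq (p : ℕ) (hp : p.Prime) (O : ValuationSubring K)
    (A₀ A₁ : Subalgebra k K) (t : K) (hle : A₀ ≤ A₁) (hfg₁ : A₁.FG) (htp : t ^ p ∈ A₀)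
    (hfr : IsFractionRing (Algebra.adjoin k (insert t (A₀ : Set K))) K)
    (h₁ : A₁.toSubring ≤ O.toSubring)
    (hzd : ∀ x ∈ O, ∃ g : k[X], g ≠ 0 ∧ aeval x g ∈ O.nonunits) {n : ℕ}
    (htr : Algebra.trdeg k K = (n : Cardinal)) :
    ringKrullDim (locAtCentre A₁.toSubring O) = (n : WithBot ℕ∞) :=
  ringKrullDim_locAtCentre_eq_of_trdeg_eq O A₁ t hp.ne_zero hfg₁ (hle htp)
    (isFractionRing_of_le (Algebra.adjoin_mono (Set.insert_subset_insert fun _ hx => hle hx)) hfr)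
    h₁ hzd htr

end PDegreeAtCentre

end Summit.ResolutionOfSingularities.ResolutionOfSingularities.Theorems.SwitchingDichotomy

end
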